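import Literature.MathematicalPhysics.QuantumFieldTheory.Balaban1983to89.B1Eq324BenfattoKernelSect5Eq513
import Literature.MathematicalPhysics.QuantumFieldTheory.Balaban1983to89.B1Eq324BenfattoSect5Eq515
import HarnessLib

/-!
# `Balaban1983to89.B1Eq324BenfattoKernelSect5Eq515` — [BenfattoEtAl1978] §5 p. 155, (5.13) → (5.15) first line, FOR THE CLASS of
# [Balaban1985BackgroundPropagators] Sect. E p. 428: the product over the boxes of a §5 pavement under the Gaussian field of an exponentially
# decaying precision, two-sided, with the cut-offs' bounded-fluctuation budget DISCHARGED, PROVED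

statement-level skeleton of published theorems with citation tags; proofs where landed; nothing here is a claim about the
Yang–Mills mass gap

WHY THIS MODULE (cell `pub-ymgap`, seat `dag-n08-d` gen 13, INTENT-53 file (B); node N08 [Balaban1985UV3]; the [BenfattoEtAl1978] source chain behind
the (α)-row `h324`).  The concrete module `…Sect5Eq515` (this seat, gen 9) proves print's (5.13) for the product over the boxes of a pavement as an
IDENTITY under [2]'s free field `P̂₀` (exact Markov property) and, from it, the first line of (5.15).  At T. Bałaban's data ([Balaban1982Higgs1] p. 616
cites [2] §5 for covariances that are NOT [2]'s: background-dependent, exponentially decaying precisions) the exact Markov property is replaced by the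
TEMPERATURE-ZERO COMPARISON of `…KernelComparisonBounded` (J5-T), read in the consumer's currency by file (A) `…KernelSect5Eq513`: under the conditioned
class field, an observable supported in a bounded-fluctuation region `Σ_y r_y (z_y − u_{Γ₁}(ξ)_y)² ≤ T` integrates within `e^{±(ρ + T/2)}` of its integral
against the product of the PART FIELDS of the sub-precisions.  This file carries that substitute through §5's cut-off geometry — the step that decides
whether a §5-side re-run over the class is possible at all: (i) the §5 integrands DO live in such a region, because EVERY tessera carries a cut-off
`χ̂_Δ = χ(|z_Δ| ≤ b(1+d(Δ,I)))` ((5.14): `χ^{Γ₁}_{γb}` on the corridors, `χ^□_b` inside the boxes, `χ_b` on the far region) and the centre `u_{Γ₁}(ξ)`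
has the same profile on the corridor event ((C.8); for the class `…KernelOfPrecision.abs_condMean_kernel_le_profile`, displayed here as the row `hu`),
so the budget is `T = (1 + C_u)²b²·Σ_{y∈Λ∖Γ₁} r_y(1+d(I,y))²` with `r_y` the cross-part row mass of the precision at `y` — small and |B|-extensive once
`r_y ≲ e^{−κ′(w + depth(y))}` (the port-time geometric lemma on the Combes–Thomas rows; not here); (ii) NO corridor-width hypothesis survives: `w`
enters only through the size of `r_y`; (iii) the per-box measures the §5 estimates then meet are the part fields of file (A).

OBJECTS (all displayed; no definition is made).  The class kernel `K` of a symmetric `γ_A`-coercive precision `A` on a finite window `Λ ⊂ Q₀`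
(`hK`, as in `…KernelOfPrecision`); `μ_K = 𝒩(0,K)`; §5 geometry from `…Sect5Boxes` / `…Sect5Eq515` (`box L m`, `shrink L m w = □′∪Γ₂(□)`,
`frame1 = Γ₁(□)`, `corridors L w B = Γ₁ ⊆ Λ`, the far region `out L B`, the regional cut-offs `smallFieldOn R I c`); the PARTS of `Λ ∖ Γ₁`:
`shrink L m w` (`m ∈ B`) and the far part `(Λ ∖ Γ₁).filter (∀ m ∈ B, · ∉ box L m)`, labelled by `π : ↥(Λ ∖ Γ₁) → Option ↥B` (`hπ : π y = some m ↔ y ∈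
shrink L m w`); their part kernels `K_m`, `K_out` (rows `hKb`, `hKout`) and part fields `N^K_{m,ξ}`, `N^K_{out,ξ}` (file (A)); cross-row sums
`Σ_{π y′ ≠ π y}|A_{yy′}| ≤ r_y ≤ r_max < γ_A` (rows `hr`, `hrmax`, `hγr`, verbatim J5-T), `ρ := Σ_y r_y/(γ_A − r_max)`; the centre row `hu`; the budget row `hT`;
the Hamiltonian data of `…Sect5Eq515.integral_boxes_factorise_eq` verbatim.

WHAT IS PROVED (standard axioms; no `sorry`; no definition).
* §1 `shrink_subset_sdiff_corridors`; `indicator_smallFieldOn_out_eq_of_eq_zero` — for a configuration vanishing off `Λ` the far cut-off `χ^{out}_b`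
  (a condition at EVERY site outside the boxes of `B`) is the cut-off on the far part of `Λ ∖ Γ₁` (under the class fields this is almost sure, file (A)).
* §2 ★★★ `integral_boxes_factorise_ge` / `integral_boxes_factorise_le` — THE CLASS TWIN OF `…Sect5Eq515.integral_boxes_factorise_eq`, two-sided, for
  ANY per-box weights `W_□` reading `□` only, measurable, bounded on the cut-offs' support:
  `e^{−(ρ+T/2)}·∫ χ^{Γ₁}_{γb}(ξ)e^{H_{Γ₁}(ξ)}·[∫χ^{out}_b dN^K_{out,ξ}]·Π_□[∫ χ^{Γ₁(□)}_{γb}χ^□_b e^{W_□} dN^K_{□,ξ}] dμ_K(ξ)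
   ≤ ∫ χ^{Γ₁}_{γb}e^{H_{Γ₁}}·χ^{out}_b·Π_□(χ^{Γ₁(□)}_{γb}χ^□_b e^{W_□}) dμ_K ≤ e^{ρ+T/2}·(the same ξ-integral)`
  (tower `…KernelCondField.integral_eq_integral_condFieldK`; under `P̄^K_{Γ₁,ξ}` the `Γ₁`-values are `ξ`'s and the field vanishes off `Λ` a.s., so the
  prefactor comes out and the far cut-off is read inside `Λ`; file (A)'s two-sided (5.13) with the budget `t_y = r_y((1+C_u)b(1+d(I,y)))²` read off the
  cut-offs and `hu`; integrability of the parametrised part integrals by file (A)'s `stronglyMeasurable_integral_shift`).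
* §2 ★★ `integral_cutoff_exp_hatH_ge` — CLASS (5.15) FIRST LINE: with `W_□ = Ψ_□`,
  `e^{−(ρ+T/2)}·∫ χ^{Γ₁}_{γb}(ξ)e^{H_{Γ₁}(ξ)}·[∫χ^{out}_b dN^K_{out,ξ}]·Π_□[∫χ^{Γ₁(□)}_{γb}χ^□_b e^{Ψ_□}dN^K_{□,ξ}] dμ_K(ξ) ≤ ∫ Π_Δχ̂_Δ e^{Ĥ_J} dμ_K`
  (the pointwise first `≧` of (5.15), `…Sect5Eq515.boxes_integrand_psiBox_le_cutoffBoltzmann`, is kernel-free).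
HONEST SCOPE.  Transport and assembly over seat n08-b's matrix estimates, this seat's J1–J5-T, file (A) and the tree's Kolmogorov field; the class, the
substitute for (5.13) and the bounded-fluctuation device are OURS (a reading of [Balaban1985BackgroundPropagators] p. 428 for [Balaban1982Higgs1] p. 616),
not print; the geometric lemma `r_y ≲ e^{−κ′(w+depth(y))}`, the per-box estimates (5.16)–(5.33) for the class, the pavement chain and every other §5-side
module are NOT here; nothing of [Balaban1985UV3] / [Balaban1985UV2] is asserted; no generalised Basic Lemma is stated; the port is not commissioned and
nothing is chained; count-neutral for N08; nothing about d = 4, the continuum, OS axioms, a mass gap or the Clay problem.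
-/

noncomputable section

open MeasureTheory ProbabilityTheory Finset Matrix WithLp
open scoped BigOperators Matrix NNReal ENNReal

namespace Literature.MathematicalPhysics.QuantumFieldTheory.Balaban1983to89.B1Eq324BenfattoKernelSect5Eq515

open Literature.MathematicalPhysics.QuantumFieldTheory
open Literature.MathematicalPhysics.QuantumFieldTheory.GaussianToolkit
open Literature.MathematicalPhysics.QuantumFieldTheory.Balaban1983to89.B1Eq324BenfattoLemma
open Literature.MathematicalPhysics.QuantumFieldTheory.Balaban1983to89.B1Eq324BenfattoKernelRegression
open Literature.MathematicalPhysics.QuantumFieldTheory.Balaban1983to89.B1Eq324BenfattoKernelOfPrecision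
open Literature.MathematicalPhysics.QuantumFieldTheory.Balaban1983to89.B1Eq324BenfattoKernelCondField
open Literature.MathematicalPhysics.QuantumFieldTheory.Balaban1983to89.B1Eq324BenfattoKernelSect5Eq513
open Literature.MathematicalPhysics.QuantumFieldTheory.Balaban1983to89.B1Eq324BenfattoClassAppendixC (posDef_of_coercive)
open Literature.MathematicalPhysics.QuantumFieldTheory.Balaban1983to89.B1Eq324BenfattoAppendixA (distToRegion_nonneg)
open Literature.MathematicalPhysics.QuantumFieldTheory.Balaban1983to89.B1Eq324BenfattoSect5Boxes
open Literature.MathematicalPhysics.QuantumFieldTheory.Balaban1983to89.B1Eq324BenfattoSect5Eq511 (s1Const)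
open Literature.MathematicalPhysics.QuantumFieldTheory.Balaban1983to89.B1Eq324BenfattoSect5Eq515

variable {d : ℕ}

/-! ## §1  §5's parts inside `Λ`: the boxes `□′∪Γ₂(□)` lie in `Λ ∖ Γ₁`; the far cut-off read inside `Λ` -/

section Parts

variable {Λ : Finset (B1Eq324BenfattoLemma.Site d)} {L w : ℕ} {B I : Finset (B1Eq324BenfattoLemma.Site d)} {b : ℝ}

/-- `□′∪Γ₂(□_m)` for `m ∈ B` lies in `Λ ∖ Γ₁` when the boxes of `B` lie in `Λ` (`L ≥ 1`; `…Sect5Boxes.disjoint_corridors_shrink`).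
[cite: BenfattoEtAl1978, (5.7)–(5.8) p.154–155] -/
theorem shrink_subset_sdiff_corridors (hL : 0 < L) (hBΛ : ∀ m ∈ B, box L m ⊆ Λ) {m : B1Eq324BenfattoLemma.Site d} (hm : m ∈ B) :
    shrink L m w ⊆ Λ \ corridors L w B := fun _ hx =>
  Finset.mem_sdiff.mpr ⟨hBΛ m hm (shrink_subset_box L m w hx),
    fun hxΓ => Finset.disjoint_left.mp (disjoint_corridors_shrink hL w B m) hxΓ hx⟩

/-- **The far cut-off read inside `Λ`**: for a configuration vanishing off `Λ` (and `b ≥ 0`), `χ^{out}_b` — a condition at EVERY site outside the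
boxes of `B` — equals the cut-off on the finitely many far sites of `Λ ∖ Γ₁` (those outside every box of `B`).
[cite: BenfattoEtAl1978, (5.13)–(5.14) p.155 (class form)] -/
theorem indicator_smallFieldOn_out_eq_of_eq_zero (hb : 0 ≤ b) {z : B1Eq324BenfattoLemma.Site d → ℝ} (hz : ∀ x, x ∉ Λ → z x = 0) :
    (smallFieldOn (out L B) I b).indicator (fun _ => (1 : ℝ)) z =
      (smallFieldOn (((Λ \ corridors L w B).filter fun x => ∀ m ∈ B, x ∉ box L m : Finset (B1Eq324BenfattoLemma.Site d)) :
          Set (B1Eq324BenfattoLemma.Site d)) I b).indicator (fun _ => (1 : ℝ)) z := by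
  have hiff : z ∈ smallFieldOn (out L B) I b ↔ z ∈ smallFieldOn (((Λ \ corridors L w B).filter fun x => ∀ m ∈ B, x ∉ box L m :
      Finset (B1Eq324BenfattoLemma.Site d)) : Set (B1Eq324BenfattoLemma.Site d)) I b := by
    simp only [smallFieldOn, Set.mem_setOf_eq, Finset.coe_filter]
    constructor
    · intro h x hx
      exact h x hx.2
    · intro h x hx
      by_cases hxΛ : x ∈ Λ
      · exact h x ⟨Finset.mem_sdiff.mpr ⟨hxΛ, not_mem_corridors_of_mem_out hx⟩, hx⟩
      · rw [hz x hxΛ, abs_zero]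
        exact mul_nonneg hb (by have := distToRegion_nonneg I x; positivity)
  by_cases h : z ∈ smallFieldOn (out L B) I b
  · rw [Set.indicator_of_mem h, Set.indicator_of_mem (hiff.mp h)]
  · rw [Set.indicator_of_notMem h, Set.indicator_of_notMem fun h' => h (hiff.mpr h')]

end Parts

/-! ## §2  (5.13) two-sided for the §5 integrand under the class field, integrated against `μ_K`; class (5.15), first line -/

section Main

variable {Λ : Finset (B1Eq324BenfattoLemma.Site d)} {A : Matrix Λ Λ ℝ}
  {K : B1Eq324BenfattoLemma.Site d → B1Eq324BenfattoLemma.Site d → ℝ}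
  (hK : ∀ x y, K x y = if h : x ∈ Λ ∧ y ∈ Λ then (A⁻¹ : Matrix Λ Λ ℝ) ⟨x, h.1⟩ ⟨y, h.2⟩ else 0)
  {s D : ℕ} {κ : ℝ} {a : Coef d} {J I : Finset (B1Eq324BenfattoLemma.Site d)} {L w : ℕ} {B : Finset (B1Eq324BenfattoLemma.Site d)}
  {γ b Ac : ℝ}
  (hAs : ∀ e e', A e e' = A e' e) {γA rmax : ℝ} (hγA0 : 0 < γA)
  (hγA : ∀ x : Λ → ℝ, γA * ∑ e, x e ^ 2 ≤ ∑ e, ∑ e', A e e' * x e * x e')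
  (hJI : J ⊆ I) (hL : 0 < L) (hγ1 : γ ≤ 1) (hb : 1 ≤ b)
  (hΓΛ : corridors L w B ⊆ Λ) (hBΛ : ∀ m ∈ B, box L m ⊆ Λ)
  (π : ↥(Λ \ corridors L w B) → Option ↥B)
  (hπ : ∀ (y : ↥(Λ \ corridors L w B)) (m : ↥B), π y = some m ↔ (y : B1Eq324BenfattoLemma.Site d) ∈ shrink L (m : B1Eq324BenfattoLemma.Site d) w)
  (r : ↥(Λ \ corridors L w B) → ℝ)
  (hr : ∀ y : ↥(Λ \ corridors L w B), ∑ y' : ↥(Λ \ corridors L w B), (if π y = π y' then (0 : ℝ) else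
    |A ⟨y, (Finset.mem_sdiff.mp y.2).1⟩ ⟨y', (Finset.mem_sdiff.mp y'.2).1⟩|) ≤ r y)
  (hrmax : ∀ y, r y ≤ rmax) (hγr : rmax < γA)
  {Kb : B1Eq324BenfattoLemma.Site d → B1Eq324BenfattoLemma.Site d → B1Eq324BenfattoLemma.Site d → ℝ}
  (hKb : ∀ m (hm : m ∈ B) x y, Kb m x y = if h : x ∈ shrink L m w ∧ y ∈ shrink L m w then
    ((A.submatrix (fun j : ↥(shrink L m w) => (⟨j, hBΛ m hm (shrink_subset_box L m w j.2)⟩ : Λ))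
      (fun j : ↥(shrink L m w) => (⟨j, hBΛ m hm (shrink_subset_box L m w j.2)⟩ : Λ)))⁻¹ :
        Matrix ↥(shrink L m w) ↥(shrink L m w) ℝ) ⟨x, h.1⟩ ⟨y, h.2⟩ else 0)
  {Kout : B1Eq324BenfattoLemma.Site d → B1Eq324BenfattoLemma.Site d → ℝ}
  (hKout : ∀ x y, Kout x y =
    if h : x ∈ ((Λ \ corridors L w B).filter fun x => ∀ m ∈ B, x ∉ box L m) ∧
        y ∈ ((Λ \ corridors L w B).filter fun x => ∀ m ∈ B, x ∉ box L m) then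
      ((A.submatrix
          (fun j : ↥((Λ \ corridors L w B).filter fun x => ∀ m ∈ B, x ∉ box L m) =>
            (⟨j, (Finset.mem_sdiff.mp (Finset.mem_filter.mp j.2).1).1⟩ : Λ))
          (fun j : ↥((Λ \ corridors L w B).filter fun x => ∀ m ∈ B, x ∉ box L m) =>
            (⟨j, (Finset.mem_sdiff.mp (Finset.mem_filter.mp j.2).1).1⟩ : Λ)))⁻¹ :
        Matrix ↥((Λ \ corridors L w B).filter fun x => ∀ m ∈ B, x ∉ box L m)
          ↥((Λ \ corridors L w B).filter fun x => ∀ m ∈ B, x ∉ box L m) ℝ) ⟨x, h.1⟩ ⟨y, h.2⟩ else 0)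
  {Cu : ℝ}
  (hu : ∀ ξ ∈ smallFieldOn (corridors L w B : Set (B1Eq324BenfattoLemma.Site d)) I (γ * b),
    ∀ y ∈ Λ \ corridors L w B, |condMean K (corridors L w B) ξ y| ≤ Cu * b * (1 + distToRegion I y))
  {T : ℝ} (hT : (1 + Cu) ^ 2 * b ^ 2 * ∑ y : ↥(Λ \ corridors L w B), r y * (1 + distToRegion I y) ^ 2 ≤ T)

include hK hAs hγA0 hγA hJI hL hγ1 hb hΓΛ hBΛ hπ hr hrmax hγr hKb hKout hu hT

/-- kernel: the inner step at a fixed datum `ξ` — the conditioned integral of §5's product integrand, rewritten with the `Γ₁`-prefactor pulled out and the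
far cut-off read inside `Λ` (almost surely), then compared two-sidedly with the product of the part-field integrals (file (A) with the budget read off the
cut-offs and the centre row). [cite: BenfattoEtAl1978, §5 (5.13)–(5.15) p.155 (class substitute at temperature zero; ours)] -/
private theorem inner_two_sided (W : B1Eq324BenfattoLemma.Site d → (B1Eq324BenfattoLemma.Site d → ℝ) → ℝ)
    (hWdep : ∀ m, ∀ z z' : B1Eq324BenfattoLemma.Site d → ℝ, (∀ x ∈ box L m, z x = z' x) → W m z = W m z')
    (hWm : ∀ m, Measurable (W m)) {KW : ℝ}
    (hWb : ∀ m, ∀ z : B1Eq324BenfattoLemma.Site d → ℝ, (∀ x ∈ J, x ∈ box L m → |z x| ≤ b) → |W m z| ≤ KW)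
    (ξ : B1Eq324BenfattoLemma.Site d → ℝ) :
    (∫ z, (smallFieldOn (corridors L w B : Set (B1Eq324BenfattoLemma.Site d)) I (γ * b)).indicator (fun _ => (1 : ℝ)) z *
          Real.exp (hamiltonian s D κ a (corridors L w B) z) *
        ((smallFieldOn (out L B) I b).indicator (fun _ => (1 : ℝ)) z *
          ∏ m ∈ B, (smallFieldOn (frame1 L w m : Set (B1Eq324BenfattoLemma.Site d)) I (γ * b)).indicator (fun _ => (1 : ℝ)) z *
              (smallFieldOn (shrink L m w : Set (B1Eq324BenfattoLemma.Site d)) I b).indicator (fun _ => (1 : ℝ)) z * Real.exp (W m z))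
        ∂((gaussianFieldOfKernel (condCov K (corridors L w B))).map
          fun (ζ : B1Eq324BenfattoLemma.Site d → ℝ) (x : B1Eq324BenfattoLemma.Site d) => condMean K (corridors L w B) ξ x + ζ x) =
      (smallFieldOn (corridors L w B : Set (B1Eq324BenfattoLemma.Site d)) I (γ * b)).indicator (fun _ => (1 : ℝ)) ξ *
          Real.exp (hamiltonian s D κ a (corridors L w B) ξ) *
        ∫ z, ((smallFieldOn (((Λ \ corridors L w B).filter fun x => ∀ m ∈ B, x ∉ box L m : Finset (B1Eq324BenfattoLemma.Site d)) :
              Set (B1Eq324BenfattoLemma.Site d)) I b).indicator (fun _ => (1 : ℝ)) z *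
          ∏ m ∈ B, (smallFieldOn (frame1 L w m : Set (B1Eq324BenfattoLemma.Site d)) I (γ * b)).indicator (fun _ => (1 : ℝ)) z *
              (smallFieldOn (shrink L m w : Set (B1Eq324BenfattoLemma.Site d)) I b).indicator (fun _ => (1 : ℝ)) z * Real.exp (W m z))
        ∂((gaussianFieldOfKernel (condCov K (corridors L w B))).map
          fun (ζ : B1Eq324BenfattoLemma.Site d → ℝ) (x : B1Eq324BenfattoLemma.Site d) => condMean K (corridors L w B) ξ x + ζ x)) ∧
    Real.exp (-((∑ y, r y) / (γA - rmax) + T / 2)) *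
        ((smallFieldOn (corridors L w B : Set (B1Eq324BenfattoLemma.Site d)) I (γ * b)).indicator (fun _ => (1 : ℝ)) ξ *
            Real.exp (hamiltonian s D κ a (corridors L w B) ξ) *
          ((∫ z, (smallFieldOn (out L B) I b).indicator (fun _ => (1 : ℝ)) z ∂((gaussianFieldOfKernel Kout).map
              fun (ζ : B1Eq324BenfattoLemma.Site d → ℝ) (x : B1Eq324BenfattoLemma.Site d) => condMean K (corridors L w B) ξ x + ζ x)) *
            ∏ m ∈ B, ∫ z, (smallFieldOn (frame1 L w m : Set (B1Eq324BenfattoLemma.Site d)) I (γ * b)).indicator (fun _ => (1 : ℝ)) z *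
                (smallFieldOn (shrink L m w : Set (B1Eq324BenfattoLemma.Site d)) I b).indicator (fun _ => (1 : ℝ)) z *
                Real.exp (W m z) ∂((gaussianFieldOfKernel (Kb m)).map
              fun (ζ : B1Eq324BenfattoLemma.Site d → ℝ) (x : B1Eq324BenfattoLemma.Site d) => condMean K (corridors L w B) ξ x + ζ x))) ≤
      ∫ z, (smallFieldOn (corridors L w B : Set (B1Eq324BenfattoLemma.Site d)) I (γ * b)).indicator (fun _ => (1 : ℝ)) z *
          Real.exp (hamiltonian s D κ a (corridors L w B) z) *
        ((smallFieldOn (out L B) I b).indicator (fun _ => (1 : ℝ)) z *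
          ∏ m ∈ B, (smallFieldOn (frame1 L w m : Set (B1Eq324BenfattoLemma.Site d)) I (γ * b)).indicator (fun _ => (1 : ℝ)) z *
              (smallFieldOn (shrink L m w : Set (B1Eq324BenfattoLemma.Site d)) I b).indicator (fun _ => (1 : ℝ)) z * Real.exp (W m z))
        ∂((gaussianFieldOfKernel (condCov K (corridors L w B))).map
          fun (ζ : B1Eq324BenfattoLemma.Site d → ℝ) (x : B1Eq324BenfattoLemma.Site d) => condMean K (corridors L w B) ξ x + ζ x) ∧
    ∫ z, (smallFieldOn (corridors L w B : Set (B1Eq324BenfattoLemma.Site d)) I (γ * b)).indicator (fun _ => (1 : ℝ)) z *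
          Real.exp (hamiltonian s D κ a (corridors L w B) z) *
        ((smallFieldOn (out L B) I b).indicator (fun _ => (1 : ℝ)) z *
          ∏ m ∈ B, (smallFieldOn (frame1 L w m : Set (B1Eq324BenfattoLemma.Site d)) I (γ * b)).indicator (fun _ => (1 : ℝ)) z *
              (smallFieldOn (shrink L m w : Set (B1Eq324BenfattoLemma.Site d)) I b).indicator (fun _ => (1 : ℝ)) z * Real.exp (W m z))
        ∂((gaussianFieldOfKernel (condCov K (corridors L w B))).map
          fun (ζ : B1Eq324BenfattoLemma.Site d → ℝ) (x : B1Eq324BenfattoLemma.Site d) => condMean K (corridors L w B) ξ x + ζ x) ≤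
      Real.exp ((∑ y, r y) / (γA - rmax) + T / 2) *
        ((smallFieldOn (corridors L w B : Set (B1Eq324BenfattoLemma.Site d)) I (γ * b)).indicator (fun _ => (1 : ℝ)) ξ *
            Real.exp (hamiltonian s D κ a (corridors L w B) ξ) *
          ((∫ z, (smallFieldOn (out L B) I b).indicator (fun _ => (1 : ℝ)) z ∂((gaussianFieldOfKernel Kout).map
              fun (ζ : B1Eq324BenfattoLemma.Site d → ℝ) (x : B1Eq324BenfattoLemma.Site d) => condMean K (corridors L w B) ξ x + ζ x)) *
            ∏ m ∈ B, ∫ z, (smallFieldOn (frame1 L w m : Set (B1Eq324BenfattoLemma.Site d)) I (γ * b)).indicator (fun _ => (1 : ℝ)) z *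
                (smallFieldOn (shrink L m w : Set (B1Eq324BenfattoLemma.Site d)) I b).indicator (fun _ => (1 : ℝ)) z *
                Real.exp (W m z) ∂((gaussianFieldOfKernel (Kb m)).map
              fun (ζ : B1Eq324BenfattoLemma.Site d → ℝ) (x : B1Eq324BenfattoLemma.Site d) => condMean K (corridors L w B) ξ x + ζ x))) := by
  classical
  have hb0 : 0 ≤ b := zero_le_one.trans hb
  have hA : A.PosDef := posDef_of_coercive hAs hγA0 hγA
  have hKpsd : IsPosSemidefKernel K := isPosSemidefKernel_kernel hK hA
  have hdetΓ : IsUnit (covGram K (corridors L w B)).det := isUnit_det_covGram_kernel hK hA hΓΛ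
  have hKc : IsPosSemidefKernel (condCov K (corridors L w B)) := isPosSemidefKernel_condCov K hKpsd (corridors L w B) hdetΓ
  set Pbar := (gaussianFieldOfKernel (condCov K (corridors L w B))).map
    fun (ζ : B1Eq324BenfattoLemma.Site d → ℝ) (x : B1Eq324BenfattoLemma.Site d) => condMean K (corridors L w B) ξ x + ζ x with hPbar
  haveI : IsProbabilityMeasure Pbar := isProbabilityMeasure_condFieldK hKpsd (corridors L w B) hdetΓ ξ
  -- the far part and the parts
  set F₀ : Finset (B1Eq324BenfattoLemma.Site d) := (Λ \ (corridors L w B)).filter fun x => ∀ m ∈ B, x ∉ box L m with hF₀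
  set part : Option ↥B → Finset (B1Eq324BenfattoLemma.Site d) := fun p => p.elim F₀ fun m => shrink L (m : B1Eq324BenfattoLemma.Site d) w
    with hpart
  have hpartsub : ∀ p, part p ⊆ Λ \ (corridors L w B) := by
    rintro (_ | m)
    · exact Finset.filter_subset _ _
    · exact shrink_subset_sdiff_corridors hL hBΛ m.2
  have hpartiff : ∀ p (y : ↥(Λ \ (corridors L w B))), (y : B1Eq324BenfattoLemma.Site d) ∈ part p ↔ π y = p := by
    rintro (_ | m) y
    · simp only [hpart, Option.elim]
      constructor
      · intro hy
        rcases hπy : π y with _ | m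
        · rfl
        · exfalso
          have hys := (hπ y m).mp hπy
          exact (Finset.mem_filter.mp hy).2 (m : B1Eq324BenfattoLemma.Site d) m.2 (shrink_subset_box L _ w hys)
      · intro hy
        refine Finset.mem_filter.mpr ⟨y.2, ?_⟩
        rcases mem_corridors_or_shrink_or_out L w B (y : B1Eq324BenfattoLemma.Site d) with h1 | ⟨m, hm, h2⟩ | h3
        · exact absurd h1 (Finset.mem_sdiff.mp y.2).2
        · exact absurd ((hπ y ⟨m, hm⟩).mpr h2) (by rw [hy]; exact (Option.some_ne_none _).symm)
        · exact h3
    · simp only [hpart, Option.elim]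
      exact (hπ y m).symm
  -- the part kernels
  set Kp : Option ↥B → B1Eq324BenfattoLemma.Site d → B1Eq324BenfattoLemma.Site d → ℝ :=
    fun p => p.elim Kout fun m => Kb (m : B1Eq324BenfattoLemma.Site d) with hKp
  have hKp' : ∀ p x y, Kp p x y = if h : x ∈ part p ∧ y ∈ part p then
      ((A.submatrix (fun j : ↥(part p) => (⟨j, (Finset.mem_sdiff.mp (hpartsub p j.2)).1⟩ : Λ))
        (fun j : ↥(part p) => (⟨j, (Finset.mem_sdiff.mp (hpartsub p j.2)).1⟩ : Λ)))⁻¹ : Matrix ↥(part p) ↥(part p) ℝ)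
          ⟨x, h.1⟩ ⟨y, h.2⟩ else 0 := by
    rintro (_ | m) x y
    · exact hKout x y
    · exact hKb (m : B1Eq324BenfattoLemma.Site d) m.2 x y
  -- the observables
  set G : Option ↥B → (B1Eq324BenfattoLemma.Site d → ℝ) → ℝ := fun p z =>
    p.elim ((smallFieldOn (F₀ : Set (B1Eq324BenfattoLemma.Site d)) I b).indicator (fun _ => (1 : ℝ)) z) fun m =>
      (smallFieldOn (frame1 L w (m : B1Eq324BenfattoLemma.Site d) : Set (B1Eq324BenfattoLemma.Site d)) I (γ * b)).indicator
          (fun _ => (1 : ℝ)) z *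
        (smallFieldOn (shrink L (m : B1Eq324BenfattoLemma.Site d) w : Set (B1Eq324BenfattoLemma.Site d)) I b).indicator (fun _ => (1 : ℝ)) z *
        Real.exp (W (m : B1Eq324BenfattoLemma.Site d) z) with hG
  have hGm : ∀ p, Measurable (G p) := by
    rintro (_ | m)
    · exact measurable_indicator_smallFieldOn _ I b
    · exact ((measurable_indicator_smallFieldOn _ I (γ * b)).mul (measurable_indicator_smallFieldOn _ I b)).mul
        (hWm (m : B1Eq324BenfattoLemma.Site d)).exp
  have hG0 : ∀ p z, 0 ≤ G p z := by
    rintro (_ | m) z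
    · exact (indicator_smallFieldOn_mem_Icc _ I b z).1
    · exact mul_nonneg (mul_nonneg (indicator_smallFieldOn_mem_Icc _ I _ z).1 (indicator_smallFieldOn_mem_Icc _ I _ z).1) (Real.exp_pos _).le
  set M : Option ↥B → ℝ := fun p => p.elim 1 fun _ => Real.exp KW with hM
  have hGM : ∀ p z, G p z ≤ M p := by
    rintro (_ | m) z
    · exact (indicator_smallFieldOn_mem_Icc _ I b z).2
    · exact (le_abs_self _).trans (abs_boxObs_le hJI hγ1 hb0 (m : B1Eq324BenfattoLemma.Site d) (hWb (m : B1Eq324BenfattoLemma.Site d)) z)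
  have hGdep : ∀ p (z z' : B1Eq324BenfattoLemma.Site d → ℝ), (∀ x, x ∈ part p ∨ x ∈ (corridors L w B) → z x = z' x) → G p z = G p z' := by
    rintro (_ | m) z z' h
    · exact indicator_smallFieldOn_congr I b fun x hx => h x (Or.inl (Finset.mem_coe.mp hx))
    · refine boxObs_congr I γ b L w (m : B1Eq324BenfattoLemma.Site d) (hWdep (m : B1Eq324BenfattoLemma.Site d)) fun x hx => h x ?_
      by_cases hxs : x ∈ shrink L (m : B1Eq324BenfattoLemma.Site d) w
      · exact Or.inl hxs
      · right
        refine frame1_subset_corridors L w m.2 ?_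
        rw [frame1]
        exact Finset.mem_sdiff.mpr ⟨hx, hxs⟩
  -- the cut-offs: on the support of `G p`, the part's sites carry `|z_y| ≤ b(1 + d(I, y))`
  have hGcut : ∀ p (z : B1Eq324BenfattoLemma.Site d → ℝ), G p z ≠ 0 → ∀ y ∈ part p, |z y| ≤ b * (1 + distToRegion I y) := by
    rintro (_ | m) z hz y hy
    · have hzS : z ∈ smallFieldOn (F₀ : Set (B1Eq324BenfattoLemma.Site d)) I b := by
        by_contra hzS
        refine hz ?_
        simp only [hG, Option.elim]
        exact Set.indicator_of_notMem hzS _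
      exact hzS y (Finset.mem_coe.mpr hy)
    · have hzS : z ∈ smallFieldOn (shrink L (m : B1Eq324BenfattoLemma.Site d) w : Set (B1Eq324BenfattoLemma.Site d)) I b := by
        by_contra hzS
        refine hz ?_
        simp only [hG, Option.elim]
        rw [Set.indicator_of_notMem hzS, mul_zero, zero_mul]
      exact hzS y (Finset.mem_coe.mpr hy)
  have hr0 : ∀ y, 0 ≤ r y := fun y =>
    le_trans (Finset.sum_nonneg fun y' _ => ite_nonneg le_rfl (abs_nonneg _)) (hr y)
  -- the a.s. identifications under `P̄_ξ`
  have hprod : ∀ z : B1Eq324BenfattoLemma.Site d → ℝ,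
      (smallFieldOn (F₀ : Set (B1Eq324BenfattoLemma.Site d)) I b).indicator (fun _ => (1 : ℝ)) z *
        ∏ m ∈ B, (smallFieldOn (frame1 L w m : Set (B1Eq324BenfattoLemma.Site d)) I (γ * b)).indicator (fun _ => (1 : ℝ)) z *
          (smallFieldOn (shrink L m w : Set (B1Eq324BenfattoLemma.Site d)) I b).indicator (fun _ => (1 : ℝ)) z * Real.exp (W m z)
      = ∏ p, G p z := by
    intro z
    rw [Fintype.prod_option]
    simp only [hG, Option.elim]
    rw [Finset.prod_coe_sort B (fun m => (smallFieldOn (frame1 L w m : Set (B1Eq324BenfattoLemma.Site d)) I (γ * b)).indicator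
        (fun _ => (1 : ℝ)) z * (smallFieldOn (shrink L m w : Set (B1Eq324BenfattoLemma.Site d)) I b).indicator (fun _ => (1 : ℝ)) z *
        Real.exp (W m z))]
  set Hpre : (B1Eq324BenfattoLemma.Site d → ℝ) → ℝ := fun z =>
    (smallFieldOn ((corridors L w B) : Set (B1Eq324BenfattoLemma.Site d)) I (γ * b)).indicator (fun _ => (1 : ℝ)) z *
      Real.exp (hamiltonian s D κ a (corridors L w B) z) with hHpre
  have hHpre_congr : ∀ z : B1Eq324BenfattoLemma.Site d → ℝ, (∀ c ∈ (corridors L w B), z c = ξ c) → Hpre z = Hpre ξ := by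
    intro z hz
    simp only [hHpre]
    rw [indicator_smallFieldOn_congr I (γ * b) (fun x hx => hz x (Finset.mem_coe.mp hx)), hamiltonian_congr_eqOn (corridors L w B) hz]
  have heq1 : ∫ z, Hpre z * ((smallFieldOn (out L B) I b).indicator (fun _ => (1 : ℝ)) z *
        ∏ m ∈ B, (smallFieldOn (frame1 L w m : Set (B1Eq324BenfattoLemma.Site d)) I (γ * b)).indicator (fun _ => (1 : ℝ)) z *
          (smallFieldOn (shrink L m w : Set (B1Eq324BenfattoLemma.Site d)) I b).indicator (fun _ => (1 : ℝ)) z * Real.exp (W m z)) ∂Pbar =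
      ∫ z, Hpre ξ * ∏ p, G p z ∂Pbar := by
    refine integral_congr_ae ?_
    filter_upwards [condFieldK_ae_eqOn hKpsd (corridors L w B) hdetΓ ξ, condFieldK_ae_eq_zero_of_not_mem hK hA hΓΛ ξ] with z hz1 hz2
    rw [hHpre_congr z hz1, indicator_smallFieldOn_out_eq_of_eq_zero (L := L) (w := w) (B := B) (I := I) hb0 hz2, hprod z]
  have heq2 : ∫ z, Hpre ξ * ∏ p, G p z ∂Pbar = Hpre ξ * ∫ z, ∏ p, G p z ∂Pbar := integral_const_mul _ _
  have heq3 : ∫ z, ((smallFieldOn (F₀ : Set (B1Eq324BenfattoLemma.Site d)) I b).indicator (fun _ => (1 : ℝ)) z *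
        ∏ m ∈ B, (smallFieldOn (frame1 L w m : Set (B1Eq324BenfattoLemma.Site d)) I (γ * b)).indicator (fun _ => (1 : ℝ)) z *
          (smallFieldOn (shrink L m w : Set (B1Eq324BenfattoLemma.Site d)) I b).indicator (fun _ => (1 : ℝ)) z * Real.exp (W m z)) ∂Pbar =
      ∫ z, ∏ p, G p z ∂Pbar := integral_congr_ae (Filter.Eventually.of_forall fun z => hprod z)
  have hfirst : ∫ z, Hpre z * ((smallFieldOn (out L B) I b).indicator (fun _ => (1 : ℝ)) z *
        ∏ m ∈ B, (smallFieldOn (frame1 L w m : Set (B1Eq324BenfattoLemma.Site d)) I (γ * b)).indicator (fun _ => (1 : ℝ)) z *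
          (smallFieldOn (shrink L m w : Set (B1Eq324BenfattoLemma.Site d)) I b).indicator (fun _ => (1 : ℝ)) z * Real.exp (W m z)) ∂Pbar =
      Hpre ξ * ∫ z, ((smallFieldOn (F₀ : Set (B1Eq324BenfattoLemma.Site d)) I b).indicator (fun _ => (1 : ℝ)) z *
        ∏ m ∈ B, (smallFieldOn (frame1 L w m : Set (B1Eq324BenfattoLemma.Site d)) I (γ * b)).indicator (fun _ => (1 : ℝ)) z *
          (smallFieldOn (shrink L m w : Set (B1Eq324BenfattoLemma.Site d)) I b).indicator (fun _ => (1 : ℝ)) z * Real.exp (W m z)) ∂Pbar := by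
    rw [heq1, heq2, heq3]
  -- the product of the part-field integrals, with the far cut-off read on all of `out`
  set N : Option ↥B → Measure (B1Eq324BenfattoLemma.Site d → ℝ) := fun p => (gaussianFieldOfKernel (Kp p)).map
    fun (ζ : B1Eq324BenfattoLemma.Site d → ℝ) (x : B1Eq324BenfattoLemma.Site d) => condMean K (corridors L w B) ξ x + ζ x with hN
  have hfar : ∫ z, G none z ∂(N none) = ∫ z, (smallFieldOn (out L B) I b).indicator (fun _ => (1 : ℝ)) z ∂(N none) := by
    refine integral_congr_ae ?_
    filter_upwards [partField_ae_eq_condMean_of_not_mem (A := A) hA (hpartsub none) (hKp' none) ξ] with z hz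
    have hz0 : ∀ x, x ∉ Λ → z x = 0 := fun x hx => by
      rw [hz x fun hxF => hx (Finset.mem_sdiff.mp (hpartsub none hxF)).1]
      exact condMean_kernel_eq_zero_of_not_mem hK (corridors L w B) ξ hx
    simp only [hG, Option.elim]
    exact (indicator_smallFieldOn_out_eq_of_eq_zero (L := L) (w := w) (B := B) (I := I) hb0 hz0).symm
  have hprodN : ∏ p, ∫ z, G p z ∂(N p) =
      (∫ z, (smallFieldOn (out L B) I b).indicator (fun _ => (1 : ℝ)) z ∂(N none)) *
        ∏ m ∈ B, ∫ z, (smallFieldOn (frame1 L w m : Set (B1Eq324BenfattoLemma.Site d)) I (γ * b)).indicator (fun _ => (1 : ℝ)) z *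
          (smallFieldOn (shrink L m w : Set (B1Eq324BenfattoLemma.Site d)) I b).indicator (fun _ => (1 : ℝ)) z * Real.exp (W m z)
            ∂((gaussianFieldOfKernel (Kb m)).map
              fun (ζ : B1Eq324BenfattoLemma.Site d → ℝ) (x : B1Eq324BenfattoLemma.Site d) => condMean K (corridors L w B) ξ x + ζ x) := by
    rw [Fintype.prod_option, hfar]
    congr 1
    simp only [hN, hKp, hG, Option.elim]
    exact Finset.prod_coe_sort B (fun m => ∫ z, (smallFieldOn (frame1 L w m : Set (B1Eq324BenfattoLemma.Site d)) I (γ * b)).indicator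
        (fun _ => (1 : ℝ)) z * (smallFieldOn (shrink L m w : Set (B1Eq324BenfattoLemma.Site d)) I b).indicator (fun _ => (1 : ℝ)) z *
        Real.exp (W m z) ∂((gaussianFieldOfKernel (Kb m)).map
          fun (ζ : B1Eq324BenfattoLemma.Site d → ℝ) (x : B1Eq324BenfattoLemma.Site d) => condMean K (corridors L w B) ξ x + ζ x))
  -- §1 on the corridor event; trivial off it
  refine ⟨hfirst, ?_, ?_⟩
  · rw [hfirst]
    by_cases hξ : ξ ∈ smallFieldOn ((corridors L w B) : Set (B1Eq324BenfattoLemma.Site d)) I (γ * b)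
    · have hGt : ∀ p (z : B1Eq324BenfattoLemma.Site d → ℝ), G p z ≠ 0 → ∀ y : ↥(Λ \ (corridors L w B)), (y : B1Eq324BenfattoLemma.Site d) ∈ part p →
          r y * (z y - condMean K (corridors L w B) ξ y) ^ 2 ≤ r y * ((1 + Cu) * b * (1 + distToRegion I y)) ^ 2 := by
        intro p z hz y hy
        refine mul_le_mul_of_nonneg_left (sq_le_sq' ?_ ?_) (hr0 y)
        · have h1 := hGcut p z hz y hy
          have h2 := hu ξ hξ y y.2
          have hd := distToRegion_nonneg I (y : B1Eq324BenfattoLemma.Site d)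
          nlinarith [abs_le.mp h1, abs_le.mp h2]
        · have h1 := hGcut p z hz y hy
          have h2 := hu ξ hξ y y.2
          have hd := distToRegion_nonneg I (y : B1Eq324BenfattoLemma.Site d)
          nlinarith [abs_le.mp h1, abs_le.mp h2]
      have hT' : ∑ y : ↥(Λ \ (corridors L w B)), r y * ((1 + Cu) * b * (1 + distToRegion I y)) ^ 2 ≤ T := by
        refine le_trans (le_of_eq ?_) hT
        rw [Finset.mul_sum]
        exact Finset.sum_congr rfl fun y _ => by ring
      have hcore := exp_mul_prod_integral_part_le_integral_prod_condFieldK hK hAs hγA0 hγA hΓΛ π r hr hrmax hγr ξ part hpartsub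
        hpartiff hKp' hGm hG0 hGM hGdep hGt hT'
      rw [hprodN] at hcore
      have hH0 : 0 ≤ Hpre ξ := mul_nonneg (indicator_smallFieldOn_mem_Icc _ I _ ξ).1 (Real.exp_pos _).le
      calc Real.exp (-((∑ y, r y) / (γA - rmax) + T / 2)) * (Hpre ξ * ((∫ z, (smallFieldOn (out L B) I b).indicator
              (fun _ => (1 : ℝ)) z ∂(N none)) * ∏ m ∈ B, ∫ z, (smallFieldOn (frame1 L w m : Set (B1Eq324BenfattoLemma.Site d)) I
              (γ * b)).indicator (fun _ => (1 : ℝ)) z * (smallFieldOn (shrink L m w : Set (B1Eq324BenfattoLemma.Site d)) I b).indicator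
              (fun _ => (1 : ℝ)) z * Real.exp (W m z) ∂((gaussianFieldOfKernel (Kb m)).map
              fun (ζ : B1Eq324BenfattoLemma.Site d → ℝ) (x : B1Eq324BenfattoLemma.Site d) => condMean K (corridors L w B) ξ x + ζ x)))
          = Hpre ξ * (Real.exp (-((∑ y, r y) / (γA - rmax) + T / 2)) * ((∫ z, (smallFieldOn (out L B) I b).indicator
              (fun _ => (1 : ℝ)) z ∂(N none)) * ∏ m ∈ B, ∫ z, (smallFieldOn (frame1 L w m : Set (B1Eq324BenfattoLemma.Site d)) I
              (γ * b)).indicator (fun _ => (1 : ℝ)) z * (smallFieldOn (shrink L m w : Set (B1Eq324BenfattoLemma.Site d)) I b).indicator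
              (fun _ => (1 : ℝ)) z * Real.exp (W m z) ∂((gaussianFieldOfKernel (Kb m)).map
              fun (ζ : B1Eq324BenfattoLemma.Site d → ℝ) (x : B1Eq324BenfattoLemma.Site d) => condMean K (corridors L w B) ξ x + ζ x))) := by ring
        _ ≤ Hpre ξ * ∫ z, ∏ p, G p z ∂Pbar := mul_le_mul_of_nonneg_left hcore hH0
        _ = _ := by rw [heq3]
    · have hH : Hpre ξ = 0 := by
        simp only [hHpre]
        rw [Set.indicator_of_notMem hξ, zero_mul]
      rw [hH, Set.indicator_of_notMem hξ]
      simp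
  · rw [hfirst]
    by_cases hξ : ξ ∈ smallFieldOn ((corridors L w B) : Set (B1Eq324BenfattoLemma.Site d)) I (γ * b)
    · have hGt : ∀ p (z : B1Eq324BenfattoLemma.Site d → ℝ), G p z ≠ 0 → ∀ y : ↥(Λ \ (corridors L w B)), (y : B1Eq324BenfattoLemma.Site d) ∈ part p →
          r y * (z y - condMean K (corridors L w B) ξ y) ^ 2 ≤ r y * ((1 + Cu) * b * (1 + distToRegion I y)) ^ 2 := by
        intro p z hz y hy
        refine mul_le_mul_of_nonneg_left (sq_le_sq' ?_ ?_) (hr0 y)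
        · have h1 := hGcut p z hz y hy
          have h2 := hu ξ hξ y y.2
          have hd := distToRegion_nonneg I (y : B1Eq324BenfattoLemma.Site d)
          nlinarith [abs_le.mp h1, abs_le.mp h2]
        · have h1 := hGcut p z hz y hy
          have h2 := hu ξ hξ y y.2
          have hd := distToRegion_nonneg I (y : B1Eq324BenfattoLemma.Site d)
          nlinarith [abs_le.mp h1, abs_le.mp h2]
      have hT' : ∑ y : ↥(Λ \ (corridors L w B)), r y * ((1 + Cu) * b * (1 + distToRegion I y)) ^ 2 ≤ T := by
        refine le_trans (le_of_eq ?_) hT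
        rw [Finset.mul_sum]
        exact Finset.sum_congr rfl fun y _ => by ring
      have hcore := integral_prod_condFieldK_le_exp_mul_prod_integral_part hK hAs hγA0 hγA hΓΛ π r hr hrmax hγr ξ part hpartsub
        hpartiff hKp' hGm hG0 hGM hGdep hGt hT'
      rw [hprodN] at hcore
      have hH0 : 0 ≤ Hpre ξ := mul_nonneg (indicator_smallFieldOn_mem_Icc _ I _ ξ).1 (Real.exp_pos _).le
      calc Hpre ξ * ∫ z, ((smallFieldOn (F₀ : Set (B1Eq324BenfattoLemma.Site d)) I b).indicator (fun _ => (1 : ℝ)) z *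
              ∏ m ∈ B, (smallFieldOn (frame1 L w m : Set (B1Eq324BenfattoLemma.Site d)) I (γ * b)).indicator (fun _ => (1 : ℝ)) z *
                (smallFieldOn (shrink L m w : Set (B1Eq324BenfattoLemma.Site d)) I b).indicator (fun _ => (1 : ℝ)) z * Real.exp (W m z)) ∂Pbar
          = Hpre ξ * ∫ z, ∏ p, G p z ∂Pbar := by rw [heq3]
        _ ≤ Hpre ξ * (Real.exp ((∑ y, r y) / (γA - rmax) + T / 2) * ((∫ z, (smallFieldOn (out L B) I b).indicator
              (fun _ => (1 : ℝ)) z ∂(N none)) * ∏ m ∈ B, ∫ z, (smallFieldOn (frame1 L w m : Set (B1Eq324BenfattoLemma.Site d)) I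
              (γ * b)).indicator (fun _ => (1 : ℝ)) z * (smallFieldOn (shrink L m w : Set (B1Eq324BenfattoLemma.Site d)) I b).indicator
              (fun _ => (1 : ℝ)) z * Real.exp (W m z) ∂((gaussianFieldOfKernel (Kb m)).map
              fun (ζ : B1Eq324BenfattoLemma.Site d → ℝ) (x : B1Eq324BenfattoLemma.Site d) => condMean K (corridors L w B) ξ x + ζ x))) := mul_le_mul_of_nonneg_left hcore hH0
        _ = _ := by
          simp only [hHpre, hN, hKp, Option.elim]
          ring
    · have hH : Hpre ξ = 0 := by
        simp only [hHpre]
        rw [Set.indicator_of_notMem hξ, zero_mul]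
      rw [hH, Set.indicator_of_notMem hξ]
      simp

/-- kernel: the integrated two-sided comparison (both directions share the integrability bookkeeping).
[cite: BenfattoEtAl1978, §5 (5.13)–(5.15) p.155, (5.35)–(5.36) p.159 (class substitute at temperature zero; ours)] -/
private theorem integrated_two_sided (hκ : 0 < κ) (hJ : CoefSupportedIn a J) (hAc0 : 0 ≤ Ac)
    (hAc : ∀ p ∈ Finset.Icc 1 s, ∀ (Δ : Fin p → B1Eq324BenfattoLemma.Site d), (∀ i, Δ i ∈ J) →
      ∀ n ∈ admissible p D, |a p Δ n| ≤ Ac)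
    (W : B1Eq324BenfattoLemma.Site d → (B1Eq324BenfattoLemma.Site d → ℝ) → ℝ)
    (hWdep : ∀ m, ∀ z z' : B1Eq324BenfattoLemma.Site d → ℝ, (∀ x ∈ box L m, z x = z' x) → W m z = W m z')
    (hWm : ∀ m, Measurable (W m)) {KW : ℝ}
    (hWb : ∀ m, ∀ z : B1Eq324BenfattoLemma.Site d → ℝ, (∀ x ∈ J, x ∈ box L m → |z x| ≤ b) → |W m z| ≤ KW) :
    Real.exp (-((∑ y, r y) / (γA - rmax) + T / 2)) *
      ∫ ξ, (smallFieldOn (corridors L w B : Set (B1Eq324BenfattoLemma.Site d)) I (γ * b)).indicator (fun _ => (1 : ℝ)) ξ *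
          Real.exp (hamiltonian s D κ a (corridors L w B) ξ) *
        ((∫ z, (smallFieldOn (out L B) I b).indicator (fun _ => (1 : ℝ)) z ∂((gaussianFieldOfKernel Kout).map
              fun (ζ : B1Eq324BenfattoLemma.Site d → ℝ) (x : B1Eq324BenfattoLemma.Site d) => condMean K (corridors L w B) ξ x + ζ x)) *
          ∏ m ∈ B, ∫ z, (smallFieldOn (frame1 L w m : Set (B1Eq324BenfattoLemma.Site d)) I (γ * b)).indicator (fun _ => (1 : ℝ)) z *
              (smallFieldOn (shrink L m w : Set (B1Eq324BenfattoLemma.Site d)) I b).indicator (fun _ => (1 : ℝ)) z * Real.exp (W m z) ∂((gaussianFieldOfKernel (Kb m)).map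
              fun (ζ : B1Eq324BenfattoLemma.Site d → ℝ) (x : B1Eq324BenfattoLemma.Site d) => condMean K (corridors L w B) ξ x + ζ x)) ∂gaussianFieldOfKernel K ≤
      ∫ z, (smallFieldOn (corridors L w B : Set (B1Eq324BenfattoLemma.Site d)) I (γ * b)).indicator (fun _ => (1 : ℝ)) z *
          Real.exp (hamiltonian s D κ a (corridors L w B) z) *
        ((smallFieldOn (out L B) I b).indicator (fun _ => (1 : ℝ)) z *
          ∏ m ∈ B, (smallFieldOn (frame1 L w m : Set (B1Eq324BenfattoLemma.Site d)) I (γ * b)).indicator (fun _ => (1 : ℝ)) z *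
              (smallFieldOn (shrink L m w : Set (B1Eq324BenfattoLemma.Site d)) I b).indicator (fun _ => (1 : ℝ)) z * Real.exp (W m z)) ∂gaussianFieldOfKernel K ∧
    ∫ z, (smallFieldOn (corridors L w B : Set (B1Eq324BenfattoLemma.Site d)) I (γ * b)).indicator (fun _ => (1 : ℝ)) z *
          Real.exp (hamiltonian s D κ a (corridors L w B) z) *
        ((smallFieldOn (out L B) I b).indicator (fun _ => (1 : ℝ)) z *
          ∏ m ∈ B, (smallFieldOn (frame1 L w m : Set (B1Eq324BenfattoLemma.Site d)) I (γ * b)).indicator (fun _ => (1 : ℝ)) z *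
              (smallFieldOn (shrink L m w : Set (B1Eq324BenfattoLemma.Site d)) I b).indicator (fun _ => (1 : ℝ)) z * Real.exp (W m z)) ∂gaussianFieldOfKernel K ≤
      Real.exp ((∑ y, r y) / (γA - rmax) + T / 2) *
      ∫ ξ, (smallFieldOn (corridors L w B : Set (B1Eq324BenfattoLemma.Site d)) I (γ * b)).indicator (fun _ => (1 : ℝ)) ξ *
          Real.exp (hamiltonian s D κ a (corridors L w B) ξ) *
        ((∫ z, (smallFieldOn (out L B) I b).indicator (fun _ => (1 : ℝ)) z ∂((gaussianFieldOfKernel Kout).map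
              fun (ζ : B1Eq324BenfattoLemma.Site d → ℝ) (x : B1Eq324BenfattoLemma.Site d) => condMean K (corridors L w B) ξ x + ζ x)) *
          ∏ m ∈ B, ∫ z, (smallFieldOn (frame1 L w m : Set (B1Eq324BenfattoLemma.Site d)) I (γ * b)).indicator (fun _ => (1 : ℝ)) z *
              (smallFieldOn (shrink L m w : Set (B1Eq324BenfattoLemma.Site d)) I b).indicator (fun _ => (1 : ℝ)) z * Real.exp (W m z) ∂((gaussianFieldOfKernel (Kb m)).map
              fun (ζ : B1Eq324BenfattoLemma.Site d → ℝ) (x : B1Eq324BenfattoLemma.Site d) => condMean K (corridors L w B) ξ x + ζ x)) ∂gaussianFieldOfKernel K := by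
  classical
  have hb0 : 0 ≤ b := zero_le_one.trans hb
  have hA : A.PosDef := posDef_of_coercive hAs hγA0 hγA
  have hKpsd : IsPosSemidefKernel K := isPosSemidefKernel_kernel hK hA
  have hdetΓ : IsUnit (covGram K (corridors L w B)).det := isUnit_det_covGram_kernel hK hA hΓΛ
  have hKc : IsPosSemidefKernel (condCov K (corridors L w B)) := isPosSemidefKernel_condCov K hKpsd (corridors L w B) hdetΓ
  haveI : IsProbabilityMeasure (gaussianFieldOfKernel K) := isProbabilityMeasure_gaussianFieldOfKernel hKpsd
  haveI : IsProbabilityMeasure (gaussianFieldOfKernel (condCov K (corridors L w B))) := isProbabilityMeasure_gaussianFieldOfKernel hKc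
  have hWb' := hWb
  -- the integrand: measurable and bounded
  have hΦm : Measurable fun z : B1Eq324BenfattoLemma.Site d → ℝ => (smallFieldOn (corridors L w B : Set (B1Eq324BenfattoLemma.Site d)) I (γ * b)).indicator (fun _ => (1 : ℝ)) z *
          Real.exp (hamiltonian s D κ a (corridors L w B) z) *
        ((smallFieldOn (out L B) I b).indicator (fun _ => (1 : ℝ)) z *
          ∏ m ∈ B, (smallFieldOn (frame1 L w m : Set (B1Eq324BenfattoLemma.Site d)) I (γ * b)).indicator (fun _ => (1 : ℝ)) z *
              (smallFieldOn (shrink L m w : Set (B1Eq324BenfattoLemma.Site d)) I b).indicator (fun _ => (1 : ℝ)) z * Real.exp (W m z)) := by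
    refine ((measurable_indicator_smallFieldOn _ I (γ * b)).mul (measurable_hamiltonian _).exp).mul
      ((measurable_indicator_smallFieldOn _ I b).mul (Finset.measurable_prod _ fun m _ => ?_))
    exact ((measurable_indicator_smallFieldOn _ I (γ * b)).mul (measurable_indicator_smallFieldOn _ I b)).mul (hWm m).exp
  have hΦb : ∀ z : B1Eq324BenfattoLemma.Site d → ℝ, ‖(smallFieldOn (corridors L w B : Set (B1Eq324BenfattoLemma.Site d)) I (γ * b)).indicator (fun _ => (1 : ℝ)) z *
          Real.exp (hamiltonian s D κ a (corridors L w B) z) *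
        ((smallFieldOn (out L B) I b).indicator (fun _ => (1 : ℝ)) z *
          ∏ m ∈ B, (smallFieldOn (frame1 L w m : Set (B1Eq324BenfattoLemma.Site d)) I (γ * b)).indicator (fun _ => (1 : ℝ)) z *
              (smallFieldOn (shrink L m w : Set (B1Eq324BenfattoLemma.Site d)) I b).indicator (fun _ => (1 : ℝ)) z * Real.exp (W m z))‖ ≤
      Real.exp (s1Const s D d κ * Ac * b ^ D * (corridors L w B).card) * (1 * ∏ _m ∈ B, Real.exp KW) := by
    intro z
    rw [Real.norm_eq_abs, abs_mul]
    refine mul_le_mul (abs_corridorObs_le hκ hJ hAc0 hAc hJI hγ1 hb _ z) ?_ (abs_nonneg _) (Real.exp_pos _).le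
    rw [abs_mul, Finset.abs_prod]
    refine mul_le_mul ?_ (Finset.prod_le_prod (fun m _ => abs_nonneg _)
      fun m _ => abs_boxObs_le hJI hγ1 hb0 m (hWb m) z) (Finset.prod_nonneg fun m _ => abs_nonneg _) zero_le_one
    rw [abs_of_nonneg (indicator_smallFieldOn_mem_Icc _ I b z).1]
    exact (indicator_smallFieldOn_mem_Icc _ I b z).2
  have hΦi : Integrable (fun z : B1Eq324BenfattoLemma.Site d → ℝ => (smallFieldOn (corridors L w B : Set (B1Eq324BenfattoLemma.Site d)) I (γ * b)).indicator (fun _ => (1 : ℝ)) z *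
          Real.exp (hamiltonian s D κ a (corridors L w B) z) *
        ((smallFieldOn (out L B) I b).indicator (fun _ => (1 : ℝ)) z *
          ∏ m ∈ B, (smallFieldOn (frame1 L w m : Set (B1Eq324BenfattoLemma.Site d)) I (γ * b)).indicator (fun _ => (1 : ℝ)) z *
              (smallFieldOn (shrink L m w : Set (B1Eq324BenfattoLemma.Site d)) I b).indicator (fun _ => (1 : ℝ)) z * Real.exp (W m z))) (gaussianFieldOfKernel K) :=
    Integrable.of_bound hΦm.aestronglyMeasurable _ (ae_of_all _ hΦb)
  -- the part fields are probability measures; the parametrised part integrals are measurable and bounded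
  have hPDout : (A.submatrix
      (fun j : ↥((Λ \ corridors L w B).filter fun x => ∀ m ∈ B, x ∉ box L m) =>
        (⟨j, (Finset.mem_sdiff.mp (Finset.mem_filter.mp j.2).1).1⟩ : Λ))
      (fun j : ↥((Λ \ corridors L w B).filter fun x => ∀ m ∈ B, x ∉ box L m) =>
        (⟨j, (Finset.mem_sdiff.mp (Finset.mem_filter.mp j.2).1).1⟩ : Λ))).PosDef :=
    hA.submatrix fun a b hab => Subtype.ext (by simpa using congrArg Subtype.val hab)
  have hKoutpsd : IsPosSemidefKernel Kout := isPosSemidefKernel_kernel hKout hPDout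
  haveI : IsProbabilityMeasure (gaussianFieldOfKernel Kout) := isProbabilityMeasure_gaussianFieldOfKernel hKoutpsd
  have hKbpsd : ∀ m (hm : m ∈ B), IsPosSemidefKernel (Kb m) := fun m hm =>
    isPosSemidefKernel_kernel (hKb m hm) (hA.submatrix fun a b hab => Subtype.ext (by simpa using congrArg Subtype.val hab))
  have hLm : Measurable fun ξ : B1Eq324BenfattoLemma.Site d → ℝ => (smallFieldOn (corridors L w B : Set (B1Eq324BenfattoLemma.Site d)) I (γ * b)).indicator (fun _ => (1 : ℝ)) ξ *
          Real.exp (hamiltonian s D κ a (corridors L w B) ξ) *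
        ((∫ z, (smallFieldOn (out L B) I b).indicator (fun _ => (1 : ℝ)) z ∂((gaussianFieldOfKernel Kout).map
              fun (ζ : B1Eq324BenfattoLemma.Site d → ℝ) (x : B1Eq324BenfattoLemma.Site d) => condMean K (corridors L w B) ξ x + ζ x)) *
          ∏ m ∈ B, ∫ z, (smallFieldOn (frame1 L w m : Set (B1Eq324BenfattoLemma.Site d)) I (γ * b)).indicator (fun _ => (1 : ℝ)) z *
              (smallFieldOn (shrink L m w : Set (B1Eq324BenfattoLemma.Site d)) I b).indicator (fun _ => (1 : ℝ)) z * Real.exp (W m z) ∂((gaussianFieldOfKernel (Kb m)).map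
              fun (ζ : B1Eq324BenfattoLemma.Site d → ℝ) (x : B1Eq324BenfattoLemma.Site d) => condMean K (corridors L w B) ξ x + ζ x)) := by
    refine ((measurable_indicator_smallFieldOn _ I (γ * b)).mul (measurable_hamiltonian _).exp).mul
      ((stronglyMeasurable_integral_shift K (corridors L w B) (gaussianFieldOfKernel Kout)
        (measurable_indicator_smallFieldOn _ I b)).measurable.mul (Finset.measurable_prod _ fun m hm => ?_))
    haveI : IsProbabilityMeasure (gaussianFieldOfKernel (Kb m)) := isProbabilityMeasure_gaussianFieldOfKernel (hKbpsd m hm)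
    exact (stronglyMeasurable_integral_shift K (corridors L w B) (gaussianFieldOfKernel (Kb m))
      (((measurable_indicator_smallFieldOn _ I (γ * b)).mul (measurable_indicator_smallFieldOn _ I b)).mul (hWm m).exp)).measurable
  have hLb : ∀ ξ : B1Eq324BenfattoLemma.Site d → ℝ, ‖(smallFieldOn (corridors L w B : Set (B1Eq324BenfattoLemma.Site d)) I (γ * b)).indicator (fun _ => (1 : ℝ)) ξ *
          Real.exp (hamiltonian s D κ a (corridors L w B) ξ) *
        ((∫ z, (smallFieldOn (out L B) I b).indicator (fun _ => (1 : ℝ)) z ∂((gaussianFieldOfKernel Kout).map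
              fun (ζ : B1Eq324BenfattoLemma.Site d → ℝ) (x : B1Eq324BenfattoLemma.Site d) => condMean K (corridors L w B) ξ x + ζ x)) *
          ∏ m ∈ B, ∫ z, (smallFieldOn (frame1 L w m : Set (B1Eq324BenfattoLemma.Site d)) I (γ * b)).indicator (fun _ => (1 : ℝ)) z *
              (smallFieldOn (shrink L m w : Set (B1Eq324BenfattoLemma.Site d)) I b).indicator (fun _ => (1 : ℝ)) z * Real.exp (W m z) ∂((gaussianFieldOfKernel (Kb m)).map
              fun (ζ : B1Eq324BenfattoLemma.Site d → ℝ) (x : B1Eq324BenfattoLemma.Site d) => condMean K (corridors L w B) ξ x + ζ x))‖ ≤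
      Real.exp (s1Const s D d κ * Ac * b ^ D * (corridors L w B).card) * (1 * ∏ _m ∈ B, Real.exp KW) := by
    intro ξ
    haveI : IsProbabilityMeasure ((gaussianFieldOfKernel Kout).map
              fun (ζ : B1Eq324BenfattoLemma.Site d → ℝ) (x : B1Eq324BenfattoLemma.Site d) => condMean K (corridors L w B) ξ x + ζ x) :=
      Measure.isProbabilityMeasure_map (measurable_shift _).aemeasurable
    rw [Real.norm_eq_abs, abs_mul]
    refine mul_le_mul (abs_corridorObs_le hκ hJ hAc0 hAc hJI hγ1 hb _ ξ) ?_ (abs_nonneg _) (Real.exp_pos _).le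
    rw [abs_mul, Finset.abs_prod]
    refine mul_le_mul ?_ (Finset.prod_le_prod (fun m _ => abs_nonneg _) fun m hm => ?_)
      (Finset.prod_nonneg fun m _ => abs_nonneg _) zero_le_one
    · have h := norm_integral_le_of_norm_le_const (μ := ((gaussianFieldOfKernel Kout).map
              fun (ζ : B1Eq324BenfattoLemma.Site d → ℝ) (x : B1Eq324BenfattoLemma.Site d) => condMean K (corridors L w B) ξ x + ζ x))
        (f := fun z : B1Eq324BenfattoLemma.Site d → ℝ => (smallFieldOn (out L B) I b).indicator (fun _ => (1 : ℝ)) z) (C := 1)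
        (ae_of_all _ fun z => by
          rw [Real.norm_eq_abs, abs_of_nonneg (indicator_smallFieldOn_mem_Icc _ I b z).1]
          exact (indicator_smallFieldOn_mem_Icc _ I b z).2)
      rwa [Real.norm_eq_abs, probReal_univ, mul_one] at h
    · haveI : IsProbabilityMeasure (gaussianFieldOfKernel (Kb m)) := isProbabilityMeasure_gaussianFieldOfKernel (hKbpsd m hm)
      haveI : IsProbabilityMeasure ((gaussianFieldOfKernel (Kb m)).map
              fun (ζ : B1Eq324BenfattoLemma.Site d → ℝ) (x : B1Eq324BenfattoLemma.Site d) => condMean K (corridors L w B) ξ x + ζ x) :=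
        Measure.isProbabilityMeasure_map (measurable_shift _).aemeasurable
      have h := norm_integral_le_of_norm_le_const (μ := ((gaussianFieldOfKernel (Kb m)).map
              fun (ζ : B1Eq324BenfattoLemma.Site d → ℝ) (x : B1Eq324BenfattoLemma.Site d) => condMean K (corridors L w B) ξ x + ζ x))
        (f := fun z : B1Eq324BenfattoLemma.Site d → ℝ => (smallFieldOn (frame1 L w m : Set (B1Eq324BenfattoLemma.Site d)) I (γ * b)).indicator (fun _ => (1 : ℝ)) z *
              (smallFieldOn (shrink L m w : Set (B1Eq324BenfattoLemma.Site d)) I b).indicator (fun _ => (1 : ℝ)) z * Real.exp (W m z)) (C := Real.exp KW)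
        (ae_of_all _ fun z => by
          rw [Real.norm_eq_abs]
          exact abs_boxObs_le hJI hγ1 hb0 m (hWb m) z)
      rwa [Real.norm_eq_abs, probReal_univ, mul_one] at h
  have hLi : Integrable (fun ξ : B1Eq324BenfattoLemma.Site d → ℝ => (smallFieldOn (corridors L w B : Set (B1Eq324BenfattoLemma.Site d)) I (γ * b)).indicator (fun _ => (1 : ℝ)) ξ *
          Real.exp (hamiltonian s D κ a (corridors L w B) ξ) *
        ((∫ z, (smallFieldOn (out L B) I b).indicator (fun _ => (1 : ℝ)) z ∂((gaussianFieldOfKernel Kout).map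
              fun (ζ : B1Eq324BenfattoLemma.Site d → ℝ) (x : B1Eq324BenfattoLemma.Site d) => condMean K (corridors L w B) ξ x + ζ x)) *
          ∏ m ∈ B, ∫ z, (smallFieldOn (frame1 L w m : Set (B1Eq324BenfattoLemma.Site d)) I (γ * b)).indicator (fun _ => (1 : ℝ)) z *
              (smallFieldOn (shrink L m w : Set (B1Eq324BenfattoLemma.Site d)) I b).indicator (fun _ => (1 : ℝ)) z * Real.exp (W m z) ∂((gaussianFieldOfKernel (Kb m)).map
              fun (ζ : B1Eq324BenfattoLemma.Site d → ℝ) (x : B1Eq324BenfattoLemma.Site d) => condMean K (corridors L w B) ξ x + ζ x))) (gaussianFieldOfKernel K) :=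
    Integrable.of_bound hLm.aestronglyMeasurable _ (ae_of_all _ hLb)
  -- the conditioned integrals are measurable in the datum and bounded
  have hRm := stronglyMeasurable_integral_shift K (corridors L w B) (gaussianFieldOfKernel (condCov K (corridors L w B))) hΦm
  have hRi : Integrable (fun ξ : B1Eq324BenfattoLemma.Site d → ℝ => ∫ z, (smallFieldOn (corridors L w B : Set (B1Eq324BenfattoLemma.Site d)) I (γ * b)).indicator (fun _ => (1 : ℝ)) z *
          Real.exp (hamiltonian s D κ a (corridors L w B) z) *
        ((smallFieldOn (out L B) I b).indicator (fun _ => (1 : ℝ)) z *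
          ∏ m ∈ B, (smallFieldOn (frame1 L w m : Set (B1Eq324BenfattoLemma.Site d)) I (γ * b)).indicator (fun _ => (1 : ℝ)) z *
              (smallFieldOn (shrink L m w : Set (B1Eq324BenfattoLemma.Site d)) I b).indicator (fun _ => (1 : ℝ)) z * Real.exp (W m z)) ∂((gaussianFieldOfKernel (condCov K (corridors L w B))).map
              fun (ζ : B1Eq324BenfattoLemma.Site d → ℝ) (x : B1Eq324BenfattoLemma.Site d) => condMean K (corridors L w B) ξ x + ζ x)) (gaussianFieldOfKernel K) := by
    refine Integrable.of_bound hRm.aestronglyMeasurable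
      (Real.exp (s1Const s D d κ * Ac * b ^ D * (corridors L w B).card) * (1 * ∏ _m ∈ B, Real.exp KW)) (ae_of_all _ fun ξ => ?_)
    haveI : IsProbabilityMeasure ((gaussianFieldOfKernel (condCov K (corridors L w B))).map
        fun (ζ : B1Eq324BenfattoLemma.Site d → ℝ) (x : B1Eq324BenfattoLemma.Site d) => condMean K (corridors L w B) ξ x + ζ x) := isProbabilityMeasure_condFieldK hKpsd (corridors L w B) hdetΓ ξ
    have h := norm_integral_le_of_norm_le_const (μ := (gaussianFieldOfKernel (condCov K (corridors L w B))).map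
        fun (ζ : B1Eq324BenfattoLemma.Site d → ℝ) (x : B1Eq324BenfattoLemma.Site d) => condMean K (corridors L w B) ξ x + ζ x) (ae_of_all _ hΦb)
    rwa [probReal_univ, mul_one] at h
  -- the tower identity, then the inner step datum by datum
  rw [integral_eq_integral_condFieldK hKpsd (corridors L w B) hdetΓ hΦm hΦi, ← integral_const_mul]
  refine ⟨integral_mono_ae (hLi.const_mul _) hRi (ae_of_all _ fun ξ => (inner_two_sided hK hAs hγA0 hγA hJI hL hγ1 hb hΓΛ hBΛ π hπ r hr hrmax hγr hKb hKout hu hT W hWdep hWm hWb' ξ).2.1), ?_⟩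
  rw [← integral_const_mul]
  exact integral_mono_ae hRi (hLi.const_mul _) (ae_of_all _ fun ξ => (inner_two_sided hK hAs hγA0 hγA hJI hL hγ1 hb hΓΛ hBΛ π hπ r hr hrmax hγr hKb hKout hu hT W hWdep hWm hWb' ξ).2.2)

/-- **(5.13) FOR THE PRODUCT OVER BOXES, FOR THE CLASS — lower.**  The class twin of `…Sect5Eq515.integral_boxes_factorise_eq`: with the corridor
network `Γ₁ = corridors L w B ⊆ Λ` (`L ≥ 1`), the boxes of `B` inside `Λ`, cut-offs `χ^{Γ₁}_{γb}`, `χ^□_b`, `χ^{out}_b` (`γ ≤ 1 ≤ b`, `J ⊆ I`), ANY per-box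
weights `W_□` reading `□` only, measurable and bounded on the support of the box cut-offs, a part labelling `π` of `Λ ∖ Γ₁`, cross-row sums
`Σ_{π y′ ≠ π y}|A_{yy′}| ≤ r_y ≤ r_max < γ_A`, the centre row `hu` on the corridor event and the budget row `hT`:
`e^{−(ρ+T/2)} · ∫ χ^{Γ₁}_{γb}(ξ) e^{H_{Γ₁}(ξ)} · [∫ χ^{out}_b dN^K_{out,ξ}] · Π_□[∫ χ^{Γ₁(□)}_{γb} χ^□_b e^{W_□} dN^K_{□,ξ}] dμ_K(ξ)
  ≤ ∫ χ^{Γ₁}_{γb} e^{H_{Γ₁}} · χ^{out}_b · Π_{□∈B}(χ^{Γ₁(□)}_{γb} χ^□_b e^{W_□}) dμ_K`, `ρ = Σ_y r_y/(γ_A − r_max)` — the part fields of the sub-precisions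
replacing print's conditional box laws, the factor `e^{−(ρ+T/2)}` replacing the exact Markov property; no hypothesis on the corridor width.
[cite: BenfattoEtAl1978, §5 (5.13)–(5.15) p.155 (class substitute at temperature zero; ours)] -/
theorem integral_boxes_factorise_ge (hκ : 0 < κ) (hJ : CoefSupportedIn a J) (hAc0 : 0 ≤ Ac)
    (hAc : ∀ p ∈ Finset.Icc 1 s, ∀ (Δ : Fin p → B1Eq324BenfattoLemma.Site d), (∀ i, Δ i ∈ J) →
      ∀ n ∈ admissible p D, |a p Δ n| ≤ Ac)
    (W : B1Eq324BenfattoLemma.Site d → (B1Eq324BenfattoLemma.Site d → ℝ) → ℝ)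
    (hWdep : ∀ m, ∀ z z' : B1Eq324BenfattoLemma.Site d → ℝ, (∀ x ∈ box L m, z x = z' x) → W m z = W m z')
    (hWm : ∀ m, Measurable (W m)) {KW : ℝ}
    (hWb : ∀ m, ∀ z : B1Eq324BenfattoLemma.Site d → ℝ, (∀ x ∈ J, x ∈ box L m → |z x| ≤ b) → |W m z| ≤ KW) :
    Real.exp (-((∑ y, r y) / (γA - rmax) + T / 2)) *
      ∫ ξ, (smallFieldOn (corridors L w B : Set (B1Eq324BenfattoLemma.Site d)) I (γ * b)).indicator (fun _ => (1 : ℝ)) ξ *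
          Real.exp (hamiltonian s D κ a (corridors L w B) ξ) *
        ((∫ z, (smallFieldOn (out L B) I b).indicator (fun _ => (1 : ℝ)) z ∂((gaussianFieldOfKernel Kout).map
              fun (ζ : B1Eq324BenfattoLemma.Site d → ℝ) (x : B1Eq324BenfattoLemma.Site d) => condMean K (corridors L w B) ξ x + ζ x)) *
          ∏ m ∈ B, ∫ z, (smallFieldOn (frame1 L w m : Set (B1Eq324BenfattoLemma.Site d)) I (γ * b)).indicator (fun _ => (1 : ℝ)) z *
              (smallFieldOn (shrink L m w : Set (B1Eq324BenfattoLemma.Site d)) I b).indicator (fun _ => (1 : ℝ)) z * Real.exp (W m z) ∂((gaussianFieldOfKernel (Kb m)).map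
              fun (ζ : B1Eq324BenfattoLemma.Site d → ℝ) (x : B1Eq324BenfattoLemma.Site d) => condMean K (corridors L w B) ξ x + ζ x)) ∂gaussianFieldOfKernel K ≤
      ∫ z, (smallFieldOn (corridors L w B : Set (B1Eq324BenfattoLemma.Site d)) I (γ * b)).indicator (fun _ => (1 : ℝ)) z *
          Real.exp (hamiltonian s D κ a (corridors L w B) z) *
        ((smallFieldOn (out L B) I b).indicator (fun _ => (1 : ℝ)) z *
          ∏ m ∈ B, (smallFieldOn (frame1 L w m : Set (B1Eq324BenfattoLemma.Site d)) I (γ * b)).indicator (fun _ => (1 : ℝ)) z *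
              (smallFieldOn (shrink L m w : Set (B1Eq324BenfattoLemma.Site d)) I b).indicator (fun _ => (1 : ℝ)) z * Real.exp (W m z)) ∂gaussianFieldOfKernel K :=
  (integrated_two_sided hK hAs hγA0 hγA hJI hL hγ1 hb hΓΛ hBΛ π hπ r hr hrmax hγr hKb hKout hu hT hκ hJ hAc0 hAc W hWdep hWm hWb).1

/-- **(5.13) FOR THE PRODUCT OVER BOXES, FOR THE CLASS — upper**: with the same data,
`∫ χ^{Γ₁}_{γb} e^{H_{Γ₁}} · χ^{out}_b · Π_{□∈B}(χ^{Γ₁(□)}_{γb} χ^□_b e^{W_□}) dμ_K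
  ≤ e^{ρ+T/2} · ∫ χ^{Γ₁}_{γb}(ξ) e^{H_{Γ₁}(ξ)} · [∫ χ^{out}_b dN^K_{out,ξ}] · Π_□[∫ χ^{Γ₁(□)}_{γb} χ^□_b e^{W_□} dN^K_{□,ξ}] dμ_K(ξ)`
— print's (5.13) read backwards at (5.35), for the class. [cite: BenfattoEtAl1978, §5 (5.13) p.155, (5.35)–(5.36) p.159 (class substitute at temperature zero; ours)] -/
theorem integral_boxes_factorise_le (hκ : 0 < κ) (hJ : CoefSupportedIn a J) (hAc0 : 0 ≤ Ac)
    (hAc : ∀ p ∈ Finset.Icc 1 s, ∀ (Δ : Fin p → B1Eq324BenfattoLemma.Site d), (∀ i, Δ i ∈ J) →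
      ∀ n ∈ admissible p D, |a p Δ n| ≤ Ac)
    (W : B1Eq324BenfattoLemma.Site d → (B1Eq324BenfattoLemma.Site d → ℝ) → ℝ)
    (hWdep : ∀ m, ∀ z z' : B1Eq324BenfattoLemma.Site d → ℝ, (∀ x ∈ box L m, z x = z' x) → W m z = W m z')
    (hWm : ∀ m, Measurable (W m)) {KW : ℝ}
    (hWb : ∀ m, ∀ z : B1Eq324BenfattoLemma.Site d → ℝ, (∀ x ∈ J, x ∈ box L m → |z x| ≤ b) → |W m z| ≤ KW) :
    ∫ z, (smallFieldOn (corridors L w B : Set (B1Eq324BenfattoLemma.Site d)) I (γ * b)).indicator (fun _ => (1 : ℝ)) z *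
          Real.exp (hamiltonian s D κ a (corridors L w B) z) *
        ((smallFieldOn (out L B) I b).indicator (fun _ => (1 : ℝ)) z *
          ∏ m ∈ B, (smallFieldOn (frame1 L w m : Set (B1Eq324BenfattoLemma.Site d)) I (γ * b)).indicator (fun _ => (1 : ℝ)) z *
              (smallFieldOn (shrink L m w : Set (B1Eq324BenfattoLemma.Site d)) I b).indicator (fun _ => (1 : ℝ)) z * Real.exp (W m z)) ∂gaussianFieldOfKernel K ≤
      Real.exp ((∑ y, r y) / (γA - rmax) + T / 2) *
      ∫ ξ, (smallFieldOn (corridors L w B : Set (B1Eq324BenfattoLemma.Site d)) I (γ * b)).indicator (fun _ => (1 : ℝ)) ξ *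
          Real.exp (hamiltonian s D κ a (corridors L w B) ξ) *
        ((∫ z, (smallFieldOn (out L B) I b).indicator (fun _ => (1 : ℝ)) z ∂((gaussianFieldOfKernel Kout).map
              fun (ζ : B1Eq324BenfattoLemma.Site d → ℝ) (x : B1Eq324BenfattoLemma.Site d) => condMean K (corridors L w B) ξ x + ζ x)) *
          ∏ m ∈ B, ∫ z, (smallFieldOn (frame1 L w m : Set (B1Eq324BenfattoLemma.Site d)) I (γ * b)).indicator (fun _ => (1 : ℝ)) z *
              (smallFieldOn (shrink L m w : Set (B1Eq324BenfattoLemma.Site d)) I b).indicator (fun _ => (1 : ℝ)) z * Real.exp (W m z) ∂((gaussianFieldOfKernel (Kb m)).map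
              fun (ζ : B1Eq324BenfattoLemma.Site d → ℝ) (x : B1Eq324BenfattoLemma.Site d) => condMean K (corridors L w B) ξ x + ζ x)) ∂gaussianFieldOfKernel K :=
  (integrated_two_sided hK hAs hγA0 hγA hJI hL hγ1 hb hΓΛ hBΛ π hπ r hr hrmax hγr hKb hKout hu hT hκ hJ hAc0 hAc W hWdep hWm hWb).2

/-- **(5.13) + THE FIRST LINE OF (5.15), FOR THE CLASS — THE FACTORISED LOWER BOUND**: p. 155, *"[(5.12)] ≧ ∫P̄(dz_{Γ₁})χ^{Γ₁}_{γb}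
exp H_{Γ₁}(Π_{□∩J=∅}∫P̄(dz_□|z_{Γ₁})χ^□_b)·(Π_{□∩J≠∅}∫P̄(dz_□|z_{Γ₁})χ^□_b exp Ψ_□χ^□_b) (5.15)"*, with print's conditional box laws replaced by
the part fields of the class and the exact Markov property by the factor `e^{−(ρ+T/2)}`:
`e^{−(ρ+T/2)} · ∫ χ^{Γ₁}_{γb}(ξ) e^{H_{Γ₁}(ξ)} · [∫ χ^{out}_b dN^K_{out,ξ}] · Π_{□∈B}[∫ χ^{Γ₁(□)}_{γb} χ^□_b e^{Ψ_□} dN^K_{□,ξ}] dμ_K(ξ) ≤ ∫ Π_Δχ̂_Δ e^{Ĥ_J} dμ_K`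
(`integral_boxes_factorise_ge` at `W_□ = Ψ_□` + `…Sect5Eq515.boxes_integrand_psiBox_le_cutoffBoltzmann` + monotonicity of the integral).  The free-field
statement replaced is `…Sect5Eq515.integral_cutoff_exp_hatH_ge`. [cite: BenfattoEtAl1978, §5 (5.12)–(5.15) p.155 (class substitute at temperature zero; ours)] -/
theorem integral_cutoff_exp_hatH_ge (hκ : 0 < κ) (hJ : CoefSupportedIn a J) (hAc0 : 0 ≤ Ac)
    (hAc : ∀ p ∈ Finset.Icc 1 s, ∀ (Δ : Fin p → B1Eq324BenfattoLemma.Site d), (∀ i, Δ i ∈ J) →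
      ∀ n ∈ admissible p D, |a p Δ n| ≤ Ac) :
    Real.exp (-((∑ y, r y) / (γA - rmax) + T / 2)) *
      ∫ ξ, (smallFieldOn (corridors L w B : Set (B1Eq324BenfattoLemma.Site d)) I (γ * b)).indicator (fun _ => (1 : ℝ)) ξ *
          Real.exp (hamiltonian s D κ a (corridors L w B) ξ) *
        ((∫ z, (smallFieldOn (out L B) I b).indicator (fun _ => (1 : ℝ)) z ∂((gaussianFieldOfKernel Kout).map
              fun (ζ : B1Eq324BenfattoLemma.Site d → ℝ) (x : B1Eq324BenfattoLemma.Site d) => condMean K (corridors L w B) ξ x + ζ x)) *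
          ∏ m ∈ B, ∫ z, (smallFieldOn (frame1 L w m : Set (B1Eq324BenfattoLemma.Site d)) I (γ * b)).indicator (fun _ => (1 : ℝ)) z *
              (smallFieldOn (shrink L m w : Set (B1Eq324BenfattoLemma.Site d)) I b).indicator (fun _ => (1 : ℝ)) z * Real.exp (psiBox s D κ a L w m z) ∂((gaussianFieldOfKernel (Kb m)).map
              fun (ζ : B1Eq324BenfattoLemma.Site d → ℝ) (x : B1Eq324BenfattoLemma.Site d) => condMean K (corridors L w B) ξ x + ζ x)) ∂gaussianFieldOfKernel K ≤
      ∫ z, cutoffBoltzmann (hatH s D κ a L w B) I b z ∂gaussianFieldOfKernel K := by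
  have hA : A.PosDef := posDef_of_coercive hAs hγA0 hγA
  haveI : IsProbabilityMeasure (gaussianFieldOfKernel K) := isProbabilityMeasure_gaussianFieldOfKernel (isPosSemidefKernel_kernel hK hA)
  have hWb : ∀ m, ∀ z : B1Eq324BenfattoLemma.Site d → ℝ, (∀ x ∈ J, x ∈ box L m → |z x| ≤ b) →
      |psiBox s D κ a L w m z| ≤ 2 * s1Const s D d κ * Ac * b ^ D * (L : ℝ) ^ d := fun m z hz => abs_psiBox_le_local hκ hJ hAc0 hAc hb hz
  have h1 := integral_boxes_factorise_ge hK hAs hγA0 hγA hJI hL hγ1 hb hΓΛ hBΛ π hπ r hr hrmax hγr hKb hKout hu hT hκ hJ hAc0 hAc (fun m => psiBox s D κ a L w m)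
    (fun m z z' h => psiBox_congr_eqOn L w m h) (fun m => measurable_psiBox L w m) hWb
  refine h1.trans ?_
  have hFint : Integrable (fun z => cutoffBoltzmann (hatH s D κ a L w B) I b z) (gaussianFieldOfKernel K) := by
    refine Integrable.of_bound ?_ (Real.exp (s1Const s D d κ * Ac * b ^ D * ((corridors L w B).card + 2 * B.card * (L : ℝ) ^ d)))
      (ae_of_all _ fun z => ?_)
    · rw [cutoffBoltzmann]
      exact ((measurable_hatH L w B).exp.indicator (measurableSet_smallFieldSet I b)).aestronglyMeasurable
    · rw [Real.norm_eq_abs]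
      exact abs_cutoffBoltzmann_hatH_le hκ hJ hAc0 hAc hJI hb L w B z
  refine integral_mono_of_nonneg (Filter.Eventually.of_forall fun z => ?_) hFint
    (Filter.Eventually.of_forall fun z => boxes_integrand_psiBox_le_cutoffBoltzmann L w B I hγ1 (zero_le_one.trans hb) z)
  refine mul_nonneg (mul_nonneg (indicator_smallFieldOn_mem_Icc _ I _ z).1 (Real.exp_pos _).le)
    (mul_nonneg (indicator_smallFieldOn_mem_Icc _ I _ z).1 (Finset.prod_nonneg fun m _ => ?_))
  exact mul_nonneg (mul_nonneg (indicator_smallFieldOn_mem_Icc _ I _ z).1 (indicator_smallFieldOn_mem_Icc _ I _ z).1) (Real.exp_pos _).le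

end Main

end Literature.MathematicalPhysics.QuantumFieldTheory.Balaban1983to89.B1Eq324BenfattoKernelSect5Eq515

end
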